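import Summits.Ventures.PercRepro.C041TriangleLeafStar3MarkA
import Summits.Ventures.PercRepro.C041TriangleLeafStar3MarkB
import Summits.Ventures.PercRepro.C041TriangleLeafStar3MarkC
import Summits.Ventures.PercRepro.C041TriangleLeafStar3MarkD
import Summits.Ventures.PercRepro.C041TriangleLeafStar3MarkE
import Summits.Ventures.PercRepro.C041TriangleLeafStar3MarkF
import Summits.Ventures.PercRepro.C041TriangleLeafStar3MarkG
import Summits.Ventures.PercRepro.C041TriangleLeafStar3MarkH
import Summits.Ventures.PercRepro.C041TriangleLeafStar3MarkI

/-!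
# THEOREM (LEAF × THREE LEAVES + MARK) — coordinate 4 of the identity `θ_△(v d, v a * v b * v c * v 1) = leafStar3MarkA a b c d + leafStar3MarkB a b c d + leafStar3MarkC a b c d + leafStar3MarkD a b c d + leafStar3MarkE a b c d + leafStar3MarkF a b c d + leafStar3MarkG a b c d + leafStar3MarkH a b c d + leafStar3MarkI a b c d` (mine-3, gen 67; C-041.md §21 (bg)): the
explicit certificate's coordinate 4 agrees with the triangle map's, by `ring` over the parts' definitions (one
coordinate per module: the six expansions of 1637 terms each exceed one farm node together).
-/

namespace PercRepro

namespace RelaxedTriangle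

open TreeClosure

set_option maxHeartbeats 800000 in
/-- Coordinate 4 of the identity. -/
theorem thetaTri_leafStar3Mark_coord4 (a b c d : ℝ) :
    thetaTri (v d) (v a * v b * v c * v 1) 4 = (leafStar3MarkA a b c d + leafStar3MarkB a b c d + leafStar3MarkC a b c d + leafStar3MarkD a b c d + leafStar3MarkE a b c d + leafStar3MarkF a b c d + leafStar3MarkG a b c d + leafStar3MarkH a b c d + leafStar3MarkI a b c d) 4 := by
  simp only [leafStar3MarkA, leafStar3MarkB, leafStar3MarkC, leafStar3MarkD, leafStar3MarkE, leafStar3MarkF, leafStar3MarkG, leafStar3MarkH, leafStar3MarkI, leafStar3MarkA1, leafStar3MarkA2, leafStar3MarkA3, leafStar3MarkB1, leafStar3MarkB2, leafStar3MarkB3, leafStar3MarkC1, leafStar3MarkC2, leafStar3MarkC3, leafStar3MarkC4, leafStar3MarkD1, leafStar3MarkD2, leafStar3MarkD3, leafStar3MarkD4, leafStar3MarkD5, leafStar3MarkD6, leafStar3MarkD7, leafStar3MarkD8, leafStar3MarkE1, leafStar3MarkE2, leafStar3MarkE3, leafStar3MarkE4, leafStar3MarkF1, leafStar3MarkF2,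 leafStar3MarkF3, leafStar3MarkF4, leafStar3MarkF5, leafStar3MarkF6, leafStar3MarkF7, leafStar3MarkF8, leafStar3MarkG1, leafStar3MarkG2, leafStar3MarkG3, leafStar3MarkG4, leafStar3MarkG5, leafStar3MarkG6, leafStar3MarkG7, leafStar3MarkG8, leafStar3MarkH1, leafStar3MarkH2, leafStar3MarkH3, leafStar3MarkH4, leafStar3MarkH5, leafStar3MarkH6, leafStar3MarkI1, leafStar3MarkI2, leafStar3MarkI3, leafStar3MarkI4, thetaTri_eq_vec, Pi.add_apply, Pi.smul_apply, Pi.mul_apply, Pi.one_apply, smul_eq_mul, v]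
  simp
  ring

end RelaxedTriangle

end PercRepro
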